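import Literature.Geometry.Riemannian.RicciDeTurckNaturality
import Literature.Geometry.Riemannian.RicciDeTurckCoord
import Literature.Geometry.Riemannian.CurvatureFamilyRegularity
import Literature.Geometry.Riemannian.MetricNormSqCoord
import Literature.Geometry.Riemannian.RicciDeTurckJetEstimate
import HarnessLib

/-!
# Smooth families of metrics read in a chart: representatives and their regularity
(topic `Geometry/Riemannian`)

Ninth layer of the DeTurck decomposition of the named fact
`Literature.Geometry.Riemannian.ricciFlow_uniqueness` (`RicciFlow.lean`; Hamilton 1982,
Thm. 5.1; Topping 2006, Thm. 5.2.2), towards uniqueness of the Ricci–DeTurck flow on a closed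
manifold (hypothesis (RU) of `RicciDeTurckReduction.lean`; Andrews–Hopper 2011, §5.4.2,
Step 1) by the maximum principle applied to `|g₁ - g₂|²_h`. The maximum-point estimate
(`RicciDeTurckJetEstimate.lean`) is stated on jets of component maps `E → (E →L E →L ℝ)`; this
file manufactures those component maps from a smooth family of metrics on a manifold `M` read
in a chart (the standing convention "smooth on space-time", Topping 2006, §1.2.3), proves their
joint regularity, and delivers the Ricci–DeTurck equation in its final pointwise coordinate
form. Everything is proved; no named fact and no `sorry` is introduced.

## Contents (all proved)

* `gramOpFamily`, **`chartRep I g z t y`** — the representative of `g t` read in the chart at `z`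
  (defined on all of `ℝ × E`); `mfderiv_chartInv_eq_symmL` (`dΦ_y v = e.symmL (Φ y) v`),
  `chartRep_apply` / `val_chartPullback_eq_chartRep` (on the chart target it is the component map
  of `chartPullback I (g t) z`); **`contDiffOn_chartRep`** — joint `C^∞` regularity in `(y, t)`
  on `target × S` for a family `C^∞` on `M × S` (`IsContMDiffFamilyOn.contMDiffOn_gramOp` of
  `CurvatureFamilyRegularity.lean`); `contDiffOn_chartRep_const`, `contDiffAt_chartRep_const`.
* `fderiv_slice_eq`, `ContDiffOn.fderiv_slice`, `ContDiffOn.fderiv_fderiv_slice`,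
  `ContDiffOn.contDiffAt_slice` — partial `y`-derivatives of functions `C^∞` on `a × S`
  (`a` open, `S` of unique differentiability) are `C^∞` on `a × S`, hence jointly continuous.
* `leviCivita_chartPullback_const_apply`, `differentiableAt_chris_chartRep` — the background
  Christoffel data through the representative; **`mdifferentiableAt_deTurckField_univ`** — the
  DeTurck field of two smooth metrics is a differentiable section of `TM` everywhere
  (diffeomorphism invariance `deTurckField_comap` + the explicit representative of
  `RicciDeTurckCoord.lean` + `mdifferentiableAt_section_of_chartRepr`).
* **`IsRicciDeTurckFlow.hasDerivWithinAt_chartRep`** — for a Ricci–DeTurck flow on `M` relative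
  to a Levi-Civita background of `h`: `d/ds G_s(y)(X₀,Y₀) = ∑ gʲⁱ D²G_t(y)(bᵢ,bⱼ)(X₀,Y₀) +
  rdtLower(first-order data)(X₀,Y₀)` within `S` at `t`, at every point of every chart target
  (Andrews–Hopper 2011, §5.4: the strictly parabolic system of DeTurck's trick, pointwise).
* `eq_of_quadratic_eq` (polarization), **`isSumOfSquares_normSqCoord`** — the metric pairing
  `⟨T, T'⟩_{h(y)}` in the coordinates of a chart is a finite sum of squares of linear
  functionals (`normSq_eq_sum_sq` of `MetricNormSq.lean` in an `h`-orthogonal frame), the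
  hypothesis `JetEstimate.IsSumOfSquares` of `JetEstimate.two_mul_ip_le`.

## References

* P. Topping, *Lectures on the Ricci flow*, LMS LNS 325 (2006), §1.2.3, §5.2. [Topping2006]
* B. Andrews, C. Hopper, *The Ricci flow in Riemannian geometry*, LNM 2011 (2011), §5.4.1–§5.4.2,
  (5.10). [AndrewsHopper2011]
* S. Gallot, D. Hulin, J. Lafontaine, *Riemannian Geometry*, 3rd ed., Springer 2004, Prop. 2.54.
  [GallotHulinLafontaine2004]
* B. O'Neill, *Semi-Riemannian geometry*, Academic Press 1983, Ch. 3, Prop. 3.13, pp. 60–61.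
  [ONeill1983]
-/

noncomputable section

set_option maxSynthPendingDepth 3

open Bundle Set Function Filter FiberBundle VectorField ContinuousLinearMap TopologicalSpace
open scoped Manifold ContDiff Topology

namespace Literature.Geometry.Riemannian

open Lorentzian Lorentzian.OpensChart Lorentzian.PseudoRiemannianMetric
open Literature.Geometry.Riemannian.OpensChart

section ChartRep

variable {E : Type*} [NormedAddCommGroup E] [NormedSpace ℝ E] {H : Type*} [TopologicalSpace H]
  {I : ModelWithCorners ℝ E H} [I.Boundaryless] {M : Type*} [TopologicalSpace M]
  [ChartedSpace H M] [IsManifold I ∞ M] [FiniteDimensional ℝ E]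

variable (I) in
/-- The Gram operator of a family of metrics in the frame of the trivialization of `TM` at `z`:
`(x, t) ↦ (v, w) ↦ g_t(x)(e.symmL x v, e.symmL x w)` — verbatim the map of
`IsContMDiffFamilyOn.contMDiffOn_gramOp` (`CurvatureFamilyRegularity.lean`), named.
[cite: GallotHulinLafontaine2004, Prop. 2.54 (p. 70)] -/
def gramOpFamily (g : ℝ → PseudoRiemannianMetric I ∞ E (TangentSpace I : M → Type _)) (z : M)
    (p : M × ℝ) : E →L[ℝ] E →L[ℝ] ℝ :=
  ContinuousLinearMap.bilinearComp
    (show E →L[ℝ] E →L[ℝ] ℝ from (g p.2).val p.1)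
    (show E →L[ℝ] E from (trivializationAt E (TangentSpace I : M → Type _) z).symmL ℝ p.1)
    (show E →L[ℝ] E from (trivializationAt E (TangentSpace I : M → Type _) z).symmL ℝ p.1)

variable (I) in
/-- **The representative of a family of metrics read in the chart at `z`**: for `t : ℝ` and
`y : E`, `chartRep I g z t y = gramOpFamily I g z (Φ y, t)` with `Φ = (extChartAt I z)⁻¹`: the
bilinear map `G_t(y)(v, w) = g_t(Φ y)(X_v, X_w)` on the model space, `X_v = e.symmL (Φ y) v` the
frame of the trivialization `e` of `TM` at `z` (equal to `dΦ_y v` on the chart target,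
`mfderiv_chartInv_eq_symmL`). On the chart target this is the component map of the pulled-back
metric `chartPullback I (g t) z` (`chartRep_apply`); elsewhere it is a junk value. Defined on
all of `ℝ × E` so that ordinary calculus on `E` applies. [folklore] -/
def chartRep (g : ℝ → PseudoRiemannianMetric I ∞ E (TangentSpace I : M → Type _)) (z : M)
    (t : ℝ) (y : E) : E →L[ℝ] E →L[ℝ] ℝ :=
  gramOpFamily I g z ((extChartAt I z).symm y, t)

omit [FiniteDimensional ℝ E] in
/-- The differential of `chartInv` is the frame of the trivialization at `z`:
`dΦ_y v = e.symmL (Φ y) v` (Mathlib's `TangentBundle.symmL_trivializationAt`, the chain rule for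
`chartInv = (extChartAt I z)⁻¹ ∘ Subtype.val` and `range I = univ`). [folklore] -/
theorem mfderiv_chartInv_eq_symmL (z : M) (y : chartTarget I z) (v : E) :
    (mfderiv 𝓘(ℝ, E) I (chartInv I z) y v : TangentSpace I (chartInv I z y)) =
      (trivializationAt E (TangentSpace I : M → Type _) z).symmL ℝ (chartInv I z y) v := by
  have hx : chartInv I z y ∈ (chartAt H z).source := chartInv_mem_source z y
  rw [TangentBundle.symmL_trivializationAt hx, extChartAt_chartInv,
    ModelWithCorners.Boundaryless.range_eq_univ, mfderivWithin_univ]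
  -- `chartInv = (extChartAt I z).symm ∘ Subtype.val`
  have hcomp : chartInv I z = (extChartAt I z).symm ∘ (Subtype.val : chartTarget I z → E) := rfl
  have hval : MDifferentiableAt 𝓘(ℝ, E) 𝓘(ℝ, E) (Subtype.val : chartTarget I z → E) y :=
    (contMDiff_subtype_val (n := ∞)).mdifferentiableAt (by simp)
  have hsymm : MDifferentiableAt 𝓘(ℝ, E) I (extChartAt I z).symm (y : E) := by
    have h := mdifferentiableWithinAt_extChartAt_symm (I := I) (coe_mem_target z y)
    rwa [ModelWithCorners.Boundaryless.range_eq_univ, mdifferentiableWithinAt_univ] at h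
  have hid : mfderiv 𝓘(ℝ, E) 𝓘(ℝ, E) (Subtype.val : chartTarget I z → E) y =
      ContinuousLinearMap.id ℝ E := by
    ext w
    rw [← Lorentzian.OpensChart.extChartAt_coe y]
    exact Lorentzian.OpensChart.mfderiv_extChartAt_apply y w
  rw [hcomp, mfderiv_comp y hsymm hval]
  show mfderiv 𝓘(ℝ, E) I (extChartAt I z).symm (y : E)
    (mfderiv 𝓘(ℝ, E) 𝓘(ℝ, E) (Subtype.val : chartTarget I z → E) y v) = _
  rw [hid]
  rfl

/-- **The representative is the component map of the pulled-back metric on the chart target**: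
`chartRep g z t y v w = (chartPullback I (g t) z).val y v w` for `y ∈ chartTarget I z`.
[folklore] -/
theorem chartRep_apply (g : ℝ → PseudoRiemannianMetric I ∞ E (TangentSpace I : M → Type _))
    (z : M) (t : ℝ) (y : chartTarget I z) (v w : E) :
    chartRep I g z t y v w = (chartPullback I (g t) z).val y v w := by
  rw [val_chartPullback_apply, chartRep, gramOpFamily, ContinuousLinearMap.bilinearComp_apply]
  change (g t).val ((extChartAt I z).symm y) _ _ = (g t).val (chartInv I z y) _ _
  rw [mfderiv_chartInv_eq_symmL z y v, mfderiv_chartInv_eq_symmL z y w]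
  rfl

/-- `chartRep` as an equality of bilinear maps on the chart target (the hypothesis `hG` of the
single-chart calculus of `ChartCalculus.lean` / `RicciDeTurckCoord.lean`). [folklore] -/
theorem val_chartPullback_eq_chartRep
    (g : ℝ → PseudoRiemannianMetric I ∞ E (TangentSpace I : M → Type _)) (z : M) (t : ℝ)
    (y : chartTarget I z) : (chartPullback I (g t) z).val y = chartRep I g z t y := by
  ext v w
  exact (chartRep_apply g z t y v w).symm

omit [I.Boundaryless] in
/-- **Joint smoothness of the representative of a smooth family**: if `g` is `C^∞` on `M × S`
(`IsContMDiffFamilyOn`), then `(y, t) ↦ chartRep g z t y` is `C^∞` on `chartTarget × S` as a map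
`E × ℝ → (E →L E →L ℝ)` (the Gram operator of the family in the frame of the trivialization at
`z` is jointly smooth, `IsContMDiffFamilyOn.contMDiffOn_gramOp` of
`CurvatureFamilyRegularity.lean`, composed with the smooth inverse chart). This is the standing
convention "smooth on space-time" of the Ricci-flow literature read in a chart (Topping 2006,
§1.2.3). [cite: Topping2006, §1.2.3] -/
theorem contDiffOn_chartRep {g : ℝ → PseudoRiemannianMetric I ∞ E (TangentSpace I : M → Type _)}
    {S : Set ℝ} (hg : IsContMDiffFamilyOn ∞ g S) (z : M) :
    ContDiffOn ℝ ∞ (fun q : E × ℝ ↦ chartRep I g z q.2 q.1) ((extChartAt I z).target ×ˢ S) := by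
  rw [← contMDiffOn_iff_contDiffOn]
  have hF : ContMDiffOn (I.prod 𝓘(ℝ, ℝ)) 𝓘(ℝ, E →L[ℝ] E →L[ℝ] ℝ) ∞ (gramOpFamily I g z)
      ((trivializationAt E (TangentSpace I : M → Type _) z).baseSet ×ˢ S) :=
    hg.contMDiffOn_gramOp (x₀ := z)
  have hΨ₁ : ContMDiffOn 𝓘(ℝ, E × ℝ) I ∞ (fun q : E × ℝ ↦ (extChartAt I z).symm q.1)
      ((extChartAt I z).target ×ˢ S) :=
    (contMDiffOn_extChartAt_symm z).comp contDiff_fst.contMDiff.contMDiffOn fun q hq ↦ hq.1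
  have hΨ₂ : ContMDiffOn 𝓘(ℝ, E × ℝ) 𝓘(ℝ, ℝ) ∞ (fun q : E × ℝ ↦ q.2)
      ((extChartAt I z).target ×ˢ S) := contDiff_snd.contMDiff.contMDiffOn
  have hΨ : ContMDiffOn 𝓘(ℝ, E × ℝ) (I.prod 𝓘(ℝ, ℝ)) ∞
      (fun q : E × ℝ ↦ ((extChartAt I z).symm q.1, q.2)) ((extChartAt I z).target ×ˢ S) :=
    hΨ₁.prodMk hΨ₂
  have hmaps : MapsTo (fun q : E × ℝ ↦ ((extChartAt I z).symm q.1, q.2))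
      ((extChartAt I z).target ×ˢ S)
      ((trivializationAt E (TangentSpace I : M → Type _) z).baseSet ×ˢ S) := by
    intro q hq
    refine ⟨?_, hq.2⟩
    rw [TangentBundle.trivializationAt_baseSet, ← _root_.extChartAt_source I]
    exact (extChartAt I z).map_target hq.1
  exact hF.comp hΨ hmaps

omit [I.Boundaryless] in
/-- The representative of a single metric (constant family) is `C^∞` on the chart target.
[folklore] -/
theorem contDiffOn_chartRep_const (h : PseudoRiemannianMetric I ∞ E (TangentSpace I : M → Type _))
    (z : M) : ContDiffOn ℝ ∞ (chartRep I (fun _ ↦ h) z 0) (extChartAt I z).target := by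
  have hfam : IsContMDiffFamilyOn ∞ (fun _ : ℝ ↦ h) (univ : Set ℝ) :=
    isContMDiffFamilyOn_const h univ
  have h2 : ContDiffOn ℝ ∞ (fun q : E × ℝ ↦ chartRep I (fun _ ↦ h) z q.2 q.1)
      ((extChartAt I z).target ×ˢ (univ : Set ℝ)) := contDiffOn_chartRep hfam z
  have hι : ContDiff ℝ ∞ (fun y : E ↦ ((y, (0 : ℝ)) : E × ℝ)) := contDiff_id.prodMk contDiff_const
  have hmaps : MapsTo (fun y : E ↦ ((y, (0 : ℝ)) : E × ℝ)) (extChartAt I z).target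
      ((extChartAt I z).target ×ˢ (univ : Set ℝ)) := fun y hy ↦ ⟨hy, mem_univ _⟩
  have h3 := h2.comp hι.contDiffOn hmaps
  exact h3

/-- The representative of a single metric is `C^∞` at the points of the chart target (open).
[folklore] -/
theorem contDiffAt_chartRep_const (h : PseudoRiemannianMetric I ∞ E (TangentSpace I : M → Type _))
    (z : M) (y : chartTarget I z) : ContDiffAt ℝ ∞ (chartRep I (fun _ ↦ h) z 0) y :=
  (contDiffOn_chartRep_const h z).contDiffAt ((isOpen_extChartAt_target z).mem_nhds y.2)

/-! ### Partial derivatives in `y` of functions smooth on `(chart target) × (time set)` -/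

section Slice

variable {E : Type*} [NormedAddCommGroup E] [NormedSpace ℝ E]
  {F' : Type*} [NormedAddCommGroup F'] [NormedSpace ℝ F']

/-- **The partial `y`-derivative of a function smooth on `a × S` (`a` open, `S` of unique
differentiability) is the restriction of the total derivative within `a × S`**:
`D_y [F(·, t)](y) = D F (y, t) ∘ inl`. [folklore] -/
theorem fderiv_slice_eq {F : E × ℝ → F'} {a : Set E} {S : Set ℝ} (ha : IsOpen a)
    (hF : ContDiffOn ℝ ∞ F (a ×ˢ S)) {q : E × ℝ} (hq : q ∈ a ×ˢ S) :
    fderiv ℝ (fun y ↦ F (y, q.2)) q.1 =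
      (fderivWithin ℝ F (a ×ˢ S) q).comp (ContinuousLinearMap.inl ℝ E ℝ) := by
  have hdiff : DifferentiableWithinAt ℝ F (a ×ˢ S) q := (hF.differentiableOn (by simp)) q hq
  have hslice : HasFDerivAt (fun y : E ↦ ((y, q.2) : E × ℝ)) (ContinuousLinearMap.inl ℝ E ℝ) q.1 :=
    (hasFDerivAt_id q.1).prodMk (hasFDerivAt_const q.2 q.1)
  have hmaps : MapsTo (fun y : E ↦ ((y, q.2) : E × ℝ)) a (a ×ˢ S) := fun y hy ↦ ⟨hy, hq.2⟩
  have hcomp : HasFDerivWithinAt (fun y ↦ F (y, q.2))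
      ((fderivWithin ℝ F (a ×ˢ S) q).comp (ContinuousLinearMap.inl ℝ E ℝ)) a q.1 := by
    have h := hdiff.hasFDerivWithinAt.comp q.1 hslice.hasFDerivWithinAt hmaps
    exact h
  exact (hcomp.hasFDerivAt (ha.mem_nhds hq.1)).fderiv

/-- **Partial `y`-derivatives of a function `C^∞` on `a × S` are `C^∞` on `a × S`** (jointly in
`(y, t)`): the map `(y, t) ↦ D_y[F(·, t)](y)` (`fderiv_slice_eq` and smoothness of
`fderivWithin` on a set of unique differentiability). [folklore] -/
theorem ContDiffOn.fderiv_slice {F : E × ℝ → F'} {a : Set E} {S : Set ℝ} (ha : IsOpen a)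
    (hS : UniqueDiffOn ℝ S) (hF : ContDiffOn ℝ ∞ F (a ×ˢ S)) :
    ContDiffOn ℝ ∞ (fun q : E × ℝ ↦ fderiv ℝ (fun y ↦ F (y, q.2)) q.1) (a ×ˢ S) := by
  have hs : UniqueDiffOn ℝ (a ×ˢ S) := ha.uniqueDiffOn.prod hS
  have h1 : ContDiffOn ℝ ∞ (fun q ↦ fderivWithin ℝ F (a ×ˢ S) q) (a ×ˢ S) :=
    hF.fderivWithin hs (by exact_mod_cast le_top)
  set L : (E × ℝ →L[ℝ] F') →L[ℝ] (E →L[ℝ] F') :=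
    ContinuousLinearMap.precomp F' (ContinuousLinearMap.inl ℝ E ℝ) with hL
  have h2 : ContDiffOn ℝ ∞ (fun q ↦ L (fderivWithin ℝ F (a ×ˢ S) q)) (a ×ˢ S) :=
    L.contDiff.comp_contDiffOn h1
  refine h2.congr fun q hq ↦ ?_
  rw [hL, ContinuousLinearMap.precomp_apply]
  exact fderiv_slice_eq ha hF hq

/-- **Second partial `y`-derivatives of a function `C^∞` on `a × S` are `C^∞` on `a × S`.**
[folklore] -/
theorem ContDiffOn.fderiv_fderiv_slice {F : E × ℝ → F'} {a : Set E} {S : Set ℝ} (ha : IsOpen a)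
    (hS : UniqueDiffOn ℝ S) (hF : ContDiffOn ℝ ∞ F (a ×ˢ S)) :
    ContDiffOn ℝ ∞ (fun q : E × ℝ ↦ fderiv ℝ (fderiv ℝ (fun y ↦ F (y, q.2))) q.1) (a ×ˢ S) :=
  ContDiffOn.fderiv_slice ha hS (ContDiffOn.fderiv_slice ha hS hF)

/-- Slices of a function `C^∞` on `a × S` are `C^∞` at the points of `a` (open). [folklore] -/
theorem ContDiffOn.contDiffAt_slice {F : E × ℝ → F'} {a : Set E} {S : Set ℝ} (ha : IsOpen a)
    (hF : ContDiffOn ℝ ∞ F (a ×ˢ S)) {q : E × ℝ} (hq : q ∈ a ×ˢ S) :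
    ContDiffAt ℝ ∞ (fun y ↦ F (y, q.2)) q.1 := by
  have hι : ContDiff ℝ ∞ (fun y : E ↦ ((y, q.2) : E × ℝ)) := contDiff_id.prodMk contDiff_const
  have h := hF.comp hι.contDiffOn (fun y hy ↦ ⟨hy, hq.2⟩)
  exact h.contDiffAt (ha.mem_nhds hq.1)

end Slice

end ChartRep

/-! ### The DeTurck vector field of smooth metrics is differentiable -/

section DeTurckSmooth

variable {E : Type*} [NormedAddCommGroup E] [NormedSpace ℝ E] {H : Type*} [TopologicalSpace H]
  {I : ModelWithCorners ℝ E H} [I.Boundaryless] {M : Type*} [TopologicalSpace M]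
  [ChartedSpace H M] [IsManifold I ∞ M] [FiniteDimensional ℝ E] [CompleteSpace E]

omit [CompleteSpace E] in
/-- **The background Christoffel field through the data of the representative**: for the metric
`h` read in the chart at `z` with representative `Hr = chartRep I (fun _ ↦ h) z 0`, the action of
the Levi-Civita connection of `Φ^*h` on constant fields is represented on all of `E` by
`Cb y Y₀ X₀ = chris b (Hr⁻¹(y)) (DHr(y)) Y₀ X₀` (`leviCivita_const_apply`, `christoffel_eq_chris`).
[cite: ONeill1983, Ch. 3, Prop. 3.13] -/
theorem leviCivita_chartPullback_const_apply {ι : Type*} [Fintype ι] [DecidableEq ι]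
    (b : Module.Basis ι ℝ E) (h : PseudoRiemannianMetric I ∞ E (TangentSpace I : M → Type _))
    (z : M) [(chartPullback I h z).HasLeviCivita] (y : chartTarget I z) (Y₀ X₀ : E) :
    ((chartPullback I h z).leviCivita (fun _ : chartTarget I z ↦ (Y₀ : E)) y X₀ : E) =
      chris b (gramInv b (chartRep I (fun _ ↦ h) z 0 y)) (fderiv ℝ (chartRep I (fun _ ↦ h) z 0) y)
        Y₀ X₀ := by
  have hH : ∀ y : chartTarget I z, (chartPullback I h z).val y = chartRep I (fun _ ↦ h) z 0 y :=
    val_chartPullback_eq_chartRep (fun _ ↦ h) z 0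
  rw [leviCivita_const_apply hH y (differentiableAt_repr hH y) Y₀ X₀, christoffel_eq_chris hH b y]

omit [CompleteSpace E] in
/-- The components of the background Christoffel representative are differentiable at the points
of the chart target. [folklore] -/
theorem differentiableAt_chris_chartRep {ι : Type*} [Fintype ι] [DecidableEq ι]
    (b : Module.Basis ι ℝ E) (h : PseudoRiemannianMetric I ∞ E (TangentSpace I : M → Type _))
    (z : M) (y : chartTarget I z) (Y₀ X₀ : E) :
    DifferentiableAt ℝ (fun y' : E ↦ chris b (gramInv b (chartRep I (fun _ ↦ h) z 0 y'))
      (fderiv ℝ (chartRep I (fun _ ↦ h) z 0) y') Y₀ X₀) y := by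
  have hH : ∀ y : chartTarget I z, (chartPullback I h z).val y = chartRep I (fun _ ↦ h) z 0 y :=
    val_chartPullback_eq_chartRep (fun _ ↦ h) z 0
  have hH2 : ContDiffAt ℝ 2 (chartRep I (fun _ ↦ h) z 0) y :=
    (contDiffAt_chartRep_const h z y).of_le (WithTop.coe_le_coe.mpr le_top)
  have hGi : ∀ c a, DifferentiableAt ℝ (fun y' : E ↦ gramInv b (chartRep I (fun _ ↦ h) z 0 y') c a) y :=
    fun c a ↦ differentiableAt_gramInv_apply b (hH2.of_le one_le_two) (det_gram_repr_ne_zero hH b y) c a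
  have hK : ∀ c, DifferentiableAt ℝ
      (fun y' : E ↦ kos (fderiv ℝ (chartRep I (fun _ ↦ h) z 0) y') Y₀ X₀ (b c)) y := by
    intro c
    simp only [kos_fderiv]
    exact differentiableAt_koszulForm hH2 _ _ _
  unfold chris
  refine DifferentiableAt.fun_sum fun a _ ↦ ?_
  refine (DifferentiableAt.fun_sum fun c _ ↦ ?_).smul_const (b a)
  exact (hGi c a).mul ((hK c).const_mul _)

/-- **The DeTurck vector field of a pair of smooth metrics is a differentiable section of `TM`**
at every point: read in the chart at the point it is the DeTurck field of the pulled-back pair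
(`deTurckField_comap`, diffeomorphism invariance), which has an explicit differentiable
representative (`deTurckField_eq_sum`, `mdifferentiableAt_deTurckField` of
`RicciDeTurckCoord.lean`); conclude by `mdifferentiableAt_section_of_chartRepr`. This discharges
the differentiability hypothesis `hW` of `IsRicciDeTurckFlow.hasDerivWithinAt_chartPullback`.
[folklore] -/
theorem mdifferentiableAt_deTurckField_univ
    (g h : PseudoRiemannianMetric I ∞ E (TangentSpace I : M → Type _)) [g.HasLeviCivita]
    [h.HasLeviCivita] (x : M) :
    MDiffAt (T% (deTurckField g g.leviCivita h.leviCivita)) x := by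
  classical
  haveI := (chartPullback I g x).hasLeviCivita
  haveI := (chartPullback I h x).hasLeviCivita
  set b := Module.finBasis ℝ E with hb
  set G : E → E →L[ℝ] E →L[ℝ] ℝ := chartRep I (fun _ ↦ g) x 0 with hGdef
  set Hr : E → E →L[ℝ] E →L[ℝ] ℝ := chartRep I (fun _ ↦ h) x 0 with hHrdef
  have hG : ∀ y : chartTarget I x, (chartPullback I g x).val y = G y :=
    val_chartPullback_eq_chartRep (fun _ ↦ g) x 0
  set Cb : E → E → E → E := fun y Y₀ X₀ ↦ chris b (gramInv b (Hr y)) (fderiv ℝ Hr y) Y₀ X₀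
    with hCbdef
  have hCb : ∀ (y : chartTarget I x) (Y₀ X₀ : E),
      ((chartPullback I h x).leviCivita (fun _ : chartTarget I x ↦ (Y₀ : E)) y X₀ : E) =
        Cb y Y₀ X₀ := fun y Y₀ X₀ ↦ leviCivita_chartPullback_const_apply b h x y Y₀ X₀
  have hCd : ∀ (y : chartTarget I x) (i j : _), DifferentiableAt ℝ (fun y' : E ↦ Cb y' (b i) (b j)) y :=
    fun y i j ↦ differentiableAt_chris_chartRep b h x y (b i) (b j)
  -- the point of the chart target over `x`
  have hxs : x ∈ (chartAt H x).source := mem_chart_source H x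
  set u₀ : chartTarget I x := ⟨extChartAt I x x, (extChartAt I x).map_source
    (by rwa [_root_.extChartAt_source])⟩ with hu₀
  -- the DeTurck field of the pulled-back pair and its representative
  set W' : Π u : chartTarget I x, TangentSpace 𝓘(ℝ, E) u := fun u ↦
    deTurckField (chartPullback I g x) (chartPullback I g x).leviCivita
      (chartPullback I h x).leviCivita u with hW'
  set Wf : E → E := fun y ↦ ∑ a, (∑ c, gramInv b (G y) c a * wflatFun b G Cb y (b c)) • b a
    with hWf
  have hWrep : ∀ u : chartTarget I x, (W' u : E) = Wf u := fun u ↦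
    deTurckField_eq_sum hG b _ hCb u
  have hWfd : ∀ u : chartTarget I x, DifferentiableAt ℝ Wf u := fun u ↦
    (Lorentzian.OpensChart.mdifferentiableAt_iff u _ Wf hWrep).1
      ((mdifferentiableAt_section_iff u W').1
        (mdifferentiableAt_deTurckField hG b _ hCb u (hCd u)))
  -- naturality: `W' = Φ^* W`
  have hinv : ∀ u : chartTarget I x, (mfderiv 𝓘(ℝ, E) I (chartInv I x) u).IsInvertible := fun u ↦
    isInvertible_mfderiv_of_injective rfl (injective_mfderiv_chartInv x u)
  have hnat : ∀ u : chartTarget I x, mfderiv 𝓘(ℝ, E) I (chartInv I x) u (W' u) =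
      deTurckField g g.leviCivita h.leviCivita (chartInv I x u) := by
    intro u
    have h1 := deTurckField_comap g h contMDiff_pullbackBilin_holds (contMDiff_chartInv x)
      (injective_mfderiv_chartInv x) rfl u
    rw [mpullback_apply] at h1
    change W' u = _ at h1
    rw [h1]
    exact (hinv u).self_apply_inverse _
  -- the chart representative of `W`
  refine mdifferentiableAt_section_of_chartRepr x hxs (Wf := Wf) ?_ ?_
  · filter_upwards [(chartAt H x).open_source.mem_nhds hxs] with y hy
    set u : chartTarget I x := ⟨extChartAt I x y, (extChartAt I x).map_source
      (by rwa [_root_.extChartAt_source])⟩ with hu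
    have hΦu : chartInv I x u = y := chartInv_extChartAt x hy
    rw [← hWrep u]
    have key : (mfderiv I 𝓘(ℝ, E) (extChartAt I x) (chartInv I x u)
        (deTurckField g g.leviCivita h.leviCivita (chartInv I x u)) : E) = W' u := by
      rw [← hnat u]
      exact mfderiv_extChartAt_chartInv_apply x u (W' u)
    rw [hΦu] at key
    exact key
  · exact hWfd u₀

/-- **The Ricci–DeTurck equation in the coordinates of a chart.** For a Ricci–DeTurck flow
`(k, cov)` on `M` relative to a Levi-Civita background of `h`, a point `y` of the chart target at
`z`, a time `t ∈ S` and vectors `X₀, Y₀`, the components `s ↦ G_s(y)(X₀, Y₀)` of the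
representative `G_s = chartRep I k z s` satisfy
`d/ds G_s(y)(X₀,Y₀) = ∑ gʲⁱ D²G_t(y)(bᵢ,bⱼ)(X₀,Y₀) + rdtLower b (G_t y) g⁻¹ (DG_t y) (Γ̃ y) (DΓ̃ y) (X₀,Y₀)`
within `S` at `t`, with the background data `Γ̃ y = chris b (Hr⁻¹(y)) (DHr(y))` of
`Hr = chartRep I (fun _ ↦ h) z 0` (`IsRicciDeTurckFlow.hasDerivWithinAt_chartPullback`,
`rdt_rhs_eq_coord`, and the differentiability of the DeTurck field
`mdifferentiableAt_deTurckField_univ`). This is the quasilinear strictly parabolic system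
`∂ₜG = gᵖ𐞥∂ₚ∂_qG + F(G, ∂G)` of DeTurck's trick in its final, pointwise form
(Andrews–Hopper 2011, §5.4.1–§5.4.2). [cite: AndrewsHopper2011, §5.4.2, (5.10)] -/
theorem IsRicciDeTurckFlow.hasDerivWithinAt_chartRep {ι : Type*} [Fintype ι] [DecidableEq ι]
    (b : Module.Basis ι ℝ E)
    {k : ℝ → PseudoRiemannianMetric I ∞ E (TangentSpace I : M → Type _)}
    {cov : ℝ → CovariantDerivative I E (TangentSpace I : M → Type _)}
    {bg : CovariantDerivative I E (TangentSpace I : M → Type _)} {S : Set ℝ}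
    (hk : IsRicciDeTurckFlow k cov bg S)
    {h : PseudoRiemannianMetric I ∞ E (TangentSpace I : M → Type _)} (hbg : h.IsLeviCivita bg)
    (z : M) {t : ℝ} (ht : t ∈ S) (y : chartTarget I z) (X₀ Y₀ : E) :
    HasDerivWithinAt (fun s : ℝ ↦ chartRep I k z s y X₀ Y₀)
      ((∑ i, ∑ j, gramInv b (chartRep I k z t y) j i *
          fderiv ℝ (fderiv ℝ (chartRep I k z t)) y (b i) (b j) X₀ Y₀)
        + rdtLower b (chartRep I k z t y) (gramInv b (chartRep I k z t y))
            (fderiv ℝ (chartRep I k z t) y)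
            (fun Y₁ X₁ ↦ chris b (gramInv b (chartRep I (fun _ ↦ h) z 0 y))
              (fderiv ℝ (chartRep I (fun _ ↦ h) z 0) y) Y₁ X₁)
            (fun V Y₁ X₁ ↦ fderiv ℝ (fun y' : E ↦ chris b (gramInv b (chartRep I (fun _ ↦ h) z 0 y'))
              (fderiv ℝ (chartRep I (fun _ ↦ h) z 0) y') Y₁ X₁) y V) X₀ Y₀) S t := by
  haveI := (k t).hasLeviCivita
  haveI := h.hasLeviCivita
  haveI := (chartPullback I (k t) z).hasLeviCivita
  haveI := (chartPullback I h z).hasLeviCivita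
  have hW := mdifferentiableAt_deTurckField_univ (k t) h (chartInv I z y)
  have h1 := hk.hasDerivWithinAt_chartPullback hbg z ht y hW X₀ Y₀
  have hfun : (fun s : ℝ ↦ (chartPullback I (k s) z).val y X₀ Y₀) =
      fun s ↦ chartRep I k z s y X₀ Y₀ := by
    funext s
    exact (chartRep_apply k z s y X₀ Y₀).symm
  rw [hfun] at h1
  have hG : ∀ y : chartTarget I z, (chartPullback I (k t) z).val y = chartRep I k z t y :=
    val_chartPullback_eq_chartRep k z t
  have hCb : ∀ (y : chartTarget I z) (Y₁ X₁ : E),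
      ((chartPullback I h z).leviCivita (fun _ : chartTarget I z ↦ (Y₁ : E)) y X₁ : E) =
        (fun y' Y₁ X₁ ↦ chris b (gramInv b (chartRep I (fun _ ↦ h) z 0 y'))
          (fderiv ℝ (chartRep I (fun _ ↦ h) z 0) y') Y₁ X₁) y Y₁ X₁ := fun y Y₁ X₁ ↦
    leviCivita_chartPullback_const_apply b h z y Y₁ X₁
  have hCd : ∀ i j, DifferentiableAt ℝ (fun y' : E ↦
      (fun y' Y₁ X₁ ↦ chris b (gramInv b (chartRep I (fun _ ↦ h) z 0 y'))
        (fderiv ℝ (chartRep I (fun _ ↦ h) z 0) y') Y₁ X₁) y' (b i) (b j)) y := fun i j ↦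
    differentiableAt_chris_chartRep b h z y (b i) (b j)
  rw [rdt_rhs_eq_coord hG b _ hCb y hCd X₀ Y₀] at h1
  exact h1

end DeTurckSmooth

/-! ### The metric pairing read in a chart is a sum of squares -/

section Pairing

variable {E : Type*} [NormedAddCommGroup E] [NormedSpace ℝ E] {H : Type*} [TopologicalSpace H]
  {I : ModelWithCorners ℝ E H} [I.Boundaryless] {M : Type*} [TopologicalSpace M]
  [ChartedSpace H M] [IsManifold I ∞ M] [FiniteDimensional ℝ E]

/-- Polarization: a symmetric biadditive pairing is determined by its quadratic form.
[folklore] -/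
theorem eq_of_quadratic_eq {S : Type*} [AddCommGroup S] {q r : S → S → ℝ}
    (hqs : ∀ T T', q T T' = q T' T) (hqa : ∀ T₁ T₂ T', q (T₁ + T₂) T' = q T₁ T' + q T₂ T')
    (hrs : ∀ T T', r T T' = r T' T) (hra : ∀ T₁ T₂ T', r (T₁ + T₂) T' = r T₁ T' + r T₂ T')
    (hdiag : ∀ T, q T T = r T T) (T T' : S) : q T T' = r T T' := by
  have hq : q (T + T') (T + T') = q T T + 2 * q T T' + q T' T' := by
    rw [hqa, hqs T (T + T'), hqs T' (T + T'), hqa, hqa, hqs T' T]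
    ring
  have hr : r (T + T') (T + T') = r T T + 2 * r T T' + r T' T' := by
    rw [hra, hrs T (T + T'), hrs T' (T + T'), hra, hra, hrs T' T]
    ring
  have h := hdiag (T + T')
  rw [hq, hr, hdiag T, hdiag T'] at h
  linarith

/-- **The metric pairing `⟨T, T'⟩_{h(y)}` of bilinear forms, in the coordinates of a chart, is a
finite sum of squares of linear functionals** (the hypothesis `IsSumOfSquares` of the
maximum-point estimate `JetEstimate.two_mul_ip_le`): in an `h(y)`-orthogonal basis `e` of the
tangent space, `|T|²_h = ∑ᵢⱼ T(eⱼ, eᵢ)² / (h(eᵢ,eᵢ) h(eⱼ,eⱼ))` (`normSq_eq_sum_sq` of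
`MetricNormSq.lean`, all `h(eᵢ, eᵢ) > 0` for a Riemannian `h`), and the pairing is recovered
from the square norm by polarization. [cite: ONeill1983, Ch. 3, pp. 60–61] -/
theorem isSumOfSquares_normSqCoord {ι : Type*} [Fintype ι] [DecidableEq ι]
    (b : Module.Basis ι ℝ E) (h : PseudoRiemannianMetric I ∞ E (TangentSpace I : M → Type _))
    (hpos : h.IsRiemannian) (z : M) (y : chartTarget I z) :
    JetEstimate.IsSumOfSquares (fun T T' : E →L[ℝ] E →L[ℝ] ℝ ↦
      normSqCoord b (gramInv b (chartRep I (fun _ ↦ h) z 0 y)) T T') := by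
  classical
  set h' := chartPullback I h z with hh'
  have hH : ∀ y : chartTarget I z, h'.val y = chartRep I (fun _ ↦ h) z 0 y :=
    val_chartPullback_eq_chartRep (fun _ ↦ h) z 0
  have hpos' : ∀ v : TangentSpace 𝓘(ℝ, E) y, v ≠ 0 → 0 < h'.val y v v :=
    chartPullback_pos h z y (fun v hv ↦ hpos _ v hv)
  obtain ⟨e, he, hc⟩ := h'.exists_isOrthoᵢ_basis y
  have hcpos : ∀ i, 0 < h'.val y (e i) (e i) := fun i ↦ hpos' _ (e.ne_zero i)
  -- the squares
  set ℓ : Fin (Module.finrank ℝ (TangentSpace 𝓘(ℝ, E) y)) × Fin (Module.finrank ℝ (TangentSpace 𝓘(ℝ, E) y))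
      → (E →L[ℝ] E →L[ℝ] ℝ) →ₗ[ℝ] ℝ := fun p ↦
    { toFun := fun T ↦ T (e p.2) (e p.1) / Real.sqrt (h'.val y (e p.1) (e p.1) * h'.val y (e p.2) (e p.2))
      map_add' := fun T T' ↦ by simp only [_root_.add_apply, add_div]
      map_smul' := fun r T ↦ by
        simp only [_root_.smul_apply, smul_eq_mul, RingHom.id_apply, mul_div_assoc] }
    with hℓ
  -- the quadratic identity
  have hquad : ∀ T : E →L[ℝ] E →L[ℝ] ℝ,
      normSqCoord b (gramInv b (chartRep I (fun _ ↦ h) z 0 y)) T T = ∑ p, ℓ p T * ℓ p T := by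
    intro T
    rw [← normSq_eq_normSqCoord hH b y (bilinT y T) T (fun v w ↦ rfl),
      h'.normSq_eq_sum_sq y e he hc (bilinT y T), Fintype.sum_prod_type]
    refine Finset.sum_congr rfl fun i _ ↦ Finset.sum_congr rfl fun j _ ↦ ?_
    simp only [hℓ, LinearMap.coe_mk, AddHom.coe_mk, bilinT_apply]
    have hij : 0 < h'.val y (e i) (e i) * h'.val y (e j) (e j) := mul_pos (hcpos i) (hcpos j)
    rw [div_mul_div_comm, ← pow_two, ← pow_two, Real.sq_sqrt hij.le]
  -- polarization
  have hsym : ∀ i j, gramInv b (chartRep I (fun _ ↦ h) z 0 y) i j =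
      gramInv b (chartRep I (fun _ ↦ h) z 0 y) j i := by
    refine gramInv_symm b fun v w ↦ ?_
    rw [← hH y]
    exact h'.symm y v w
  have hpair : ∀ T T', normSqCoord b (gramInv b (chartRep I (fun _ ↦ h) z 0 y)) T T' =
      ∑ p, ℓ p T * ℓ p T' := by
    refine eq_of_quadratic_eq (fun T T' ↦ normSqCoord_comm b hsym T T')
      (fun T₁ T₂ T' ↦ normSqCoord_add_left b _ T₁ T₂ T') (fun T T' ↦ ?_) (fun T₁ T₂ T' ↦ ?_)
      hquad
    · exact Finset.sum_congr rfl fun p _ ↦ mul_comm _ _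
    · simp only [map_add, add_mul, Finset.sum_add_distrib]
  -- reindex by `Fin m`
  set eqv := Fintype.equivFin (Fin (Module.finrank ℝ (TangentSpace 𝓘(ℝ, E) y)) ×
    Fin (Module.finrank ℝ (TangentSpace 𝓘(ℝ, E) y))) with heqv
  refine ⟨_, fun k ↦ ℓ (eqv.symm k), fun T T' ↦ ?_⟩
  show normSqCoord b _ T T' = ∑ k, ℓ (eqv.symm k) T * ℓ (eqv.symm k) T'
  rw [hpair, ← eqv.sum_comp]
  simp only [Equiv.symm_apply_apply]

end Pairing

end Literature.Geometry.Riemannian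

end
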